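import Mathlib
import HarnessLib.Audit
import Summits.PneNP.PneNP.Theorems.PstarChordBridge
import Summits.PneNP.PneNP.Theorems.PstarChordForcing
import Summits.PneNP.PneNP.Theorems.PstarPathRank
import Summits.PneNP.PneNP.Theorems.PstarChordBridgeFundamental

/-!
# The bridge meets the R7 table: forced chords of a terminal core (ROUND-24, memo §9 R1+R3+R4+R7, §10 (★★); GAPTWO-PLAN S4)

FRONTIER range-avoidance ladder, rung F-N3, ROUND 24 (cell `pnp-ideate`, planner memo `r24/CORE-BOUND-NOTES.md` §9–§10; restricted-model proof
complexity — nothing here bears on `P` versus `NP`).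

`PstarChordBridge.sys I B` is the chord system of a terminal core with chord set `N` (bridge data `B`).  This file discharges, from the
INSTANCE hypotheses, everything `PstarChordForcing.forced_chord_cases` asks of a chord system on a cube:

* `free_add` — the state-free part of a G-constraint is QUADRATIC with polar form `polar T + polar G⁰` (join monomials plus private-free
  pendant monomials; `PstarProductRank.polar`);
* `sys_u_eq` — the prescribed product of chord `e` is `γ_e + Q_{D e}` with `Q_{D e} = qform (D e)` the AND-sum of its fundamental set;
* `rank_four_of_wf` — **R3 for fundamental sets**: `Q_{D e}` has rank `≥ 4` (`PstarPathRank.rank_four_of_family`, whose three combinatorial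
  hypotheses are the path-free lemmas of `PstarChordBridgeFundamental`);
* `singleRead_of_untouched`, `const_of_unread` — the single-read / constant-read regime hypotheses in instance terms (the second constraint
  touches no private; no pendant reads a private);
* `forced_chord_cases_sys` — **(★★) through the R7 table for an actual terminal core**: in that regime, an unsolvable but `e`-minimal terminal
  system forces, for every chord `e ∈ N`: (EQ) `Q_{D e} = q + κ`, or (EXC) `Q_{D e} = q + ν₁ν₂ + κ`, or (NOR) `Z(q)` is a codimension-two flat
  and `Q_{D e} + γ_e + 1` lies in its ideal — where `q = free₂ + b₂` is the second constraint on the cube;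
* `eq_of_qform_eq`, `chord_eq_of_EQ` — reading (EQ) combinatorially: AND-sums that differ by a constant come from the same output family
  (polar forms on basis vectors, `PstarPathRank.polar_basis`), and equal fundamental sets force equal chords
  (`PstarChordBridgeFundamental.eq_of_fundamental_eq`), so **at most one chord of a core is in case (EQ)** (memo R7(i) "same path ⟹ #N ≤ 1").
-/

set_option linter.dupNamespace false -- `Summit.PneNP.PneNP.…`: summit = sub-problem name (D-0017 single-conjunct layout)

open Finset Module Literature.Computability.Complexity
open Summit.PneNP.PneNP.Theorems.PstarFibrePolys (bit)
open Summit.PneNP.PneNP.Theorems.PstarTyped (Typed)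
open Summit.PneNP.PneNP.Theorems.PstarSALevel (varSet bdry BoundaryExpanding SimpleOverlap)
open Summit.PneNP.PneNP.Theorems.PstarGapLinearised (andPair andPair_subset_varSet)
open Summit.PneNP.PneNP.Theorems.PstarChordEndgameTools (not_two_shared mem_andPair_iff)
open Summit.PneNP.PneNP.Theorems.PstarCentreFree (vars_mem_varSet)
open Summit.PneNP.PneNP.Theorems.PstarXorElimination (pdeg)
open Summit.PneNP.PneNP.Theorems.PstarXCore (xpair xverts mem_xpair card_xpair_le)
open Summit.PneNP.PneNP.Theorems.PstarChordRepair (IsChord)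
open Summit.PneNP.PneNP.Theorems.PstarCubeIdeals (IsAffineFn)
open Summit.PneNP.PneNP.Theorems.PstarProductRank (qform polar polar_apply qform_add)
open Summit.PneNP.PneNP.Theorems.PstarQuadRank (rad)
open Summit.PneNP.PneNP.Theorems.PstarPathRank (AndAdj polar_basis rank_four_of_family andPair_ne)
open Summit.PneNP.PneNP.Theorems.PstarChordSystem (ChordSystem)
open Summit.PneNP.PneNP.Theorems.PstarChordForcing (forced_chord_cases)
open Summit.PneNP.PneNP.Theorems.PstarChordBridgeTools
open Summit.PneNP.PneNP.Theorems.PstarChordBridge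
open Summit.PneNP.PneNP.Theorems.PstarChordBridgeFundamental

namespace Summit.PneNP.PneNP.Theorems.PstarChordBridgeForcing

variable {n m : ℕ}

/-! ## The second constraint is quadratic -/

/-- The private-free monomials of a G-constraint. -/
def freeMon (I : LocalMap 4 n m) (N G : Finset (Fin m)) : Finset (Fin m) :=
  G.filter fun g => ¬ (I.vars g 2 ∈ privs I N ∨ I.vars g 3 ∈ privs I N)

/-- The polar form of the state-free part: join monomials plus private-free pendant monomials. -/
def freePolar (I : LocalMap 4 n m) (N T G : Finset (Fin m)) : LinearMap.BilinForm (ZMod 2) (Fin n → ZMod 2) :=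
  polar T (fun j => I.vars j 2) (fun j => I.vars j 3) + polar (freeMon I N G) (fun j => I.vars j 2) (fun j => I.vars j 3)

/-- The state-free part in `qform` language. -/
theorem free_eq (I : LocalMap 4 n m) (y : Fin m → Bool) (F N T : Finset (Fin m)) (C : Finset (Fin n)) (G : Finset (Fin m))
    (x : Fin n → ZMod 2) :
    free I y F N T C G x = ∑ v ∈ C.filter (fun v => v ∉ xverts I F ∧ v ∉ privs I N), x v + ∑ j ∈ T, bit (y j)
      + qform T (fun j => I.vars j 2) (fun j => I.vars j 3) x + qform (freeMon I N G) (fun j => I.vars j 2) (fun j => I.vars j 3) x := by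
  unfold free freeMon qform
  rw [sum_add_distrib]
  ring

/-- **The state-free part is quadratic**, with polar form `freePolar`. -/
theorem free_add (I : LocalMap 4 n m) (y : Fin m → Bool) (F N T : Finset (Fin m)) (C : Finset (Fin n)) (G : Finset (Fin m))
    (x w : Fin n → ZMod 2) :
    free I y F N T C G (x + w) = free I y F N T C G x + free I y F N T C G w + free I y F N T C G 0 + freePolar I N T G x w := by
  simp only [free_eq, qform_add, freePolar, LinearMap.add_apply]
  have h0 : ∀ S : Finset (Fin m), qform S (fun j => I.vars j 2) (fun j => I.vars j 3) (0 : Fin n → ZMod 2) = 0 := fun S => by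
    simp only [qform, Pi.zero_apply, mul_zero, sum_const_zero]
  have hl : ∑ v ∈ C.filter (fun v => v ∉ xverts I F ∧ v ∉ privs I N), (x + w) v =
      ∑ v ∈ C.filter (fun v => v ∉ xverts I F ∧ v ∉ privs I N), x v + ∑ v ∈ C.filter (fun v => v ∉ xverts I F ∧ v ∉ privs I N), w v := by
    simp only [Pi.add_apply, sum_add_distrib]
  have hl0 : ∑ v ∈ C.filter (fun v => v ∉ xverts I F ∧ v ∉ privs I N), (0 : Fin n → ZMod 2) v = 0 := by simp
  rw [h0, h0, hl, hl0]
  have hY : ∑ j ∈ T, bit (y j) + ∑ j ∈ T, bit (y j) = 0 := by generalize ∑ j ∈ T, bit (y j) = t; revert t; decide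
  linear_combination (-1 : ZMod 2) * hY

/-- The second constraint of the model, `q := F₂ + t₂`, satisfies the polar identity with `freePolar`. -/
theorem sys_q_add (I : LocalMap 4 n m) (B : BridgeData n m) (x w : Fin n → ZMod 2) :
    ((sys I B).F (x + w)).2 + (sys I B).t.2 = (((sys I B).F x).2 + (sys I B).t.2) + (((sys I B).F w).2 + (sys I B).t.2)
      + (((sys I B).F 0).2 + (sys I B).t.2) + freePolar I B.N B.T₂ B.G₂ x w := by
  simp only [sys_F, sys_t]
  rw [free_add]
  have h3 : ∀ t : ZMod 2, t = t + t + t := by decide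
  linear_combination h3 (bit B.b₂)

/-! ## The prescribed product is `γ + Q_D` -/

/-- The constant of chord `e`: `γ_e = y_e + Σ_{j ∈ D e} y_j`. -/
def gam (B : BridgeData n m) (e : Fin m) : ZMod 2 := bit (B.y e) + ∑ j ∈ B.D e, bit (B.y j)

/-- **`u_e = γ_e + Q_{D e}`.** -/
theorem sys_u_eq (I : LocalMap 4 n m) (B : BridgeData n m) (e : Fin m) (x : Fin n → ZMod 2) :
    (sys I B).u e x = gam B e + qform (B.D e) (fun j => I.vars j 2) (fun j => I.vars j 3) x := by
  rw [sys_u]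
  unfold uval gam qform
  rw [sum_add_distrib, add_assoc]

/-- The polar identity of `Q_{D e}`. -/
theorem qform_add' (I : LocalMap 4 n m) (D : Finset (Fin m)) (x w : Fin n → ZMod 2) :
    qform D (fun j => I.vars j 2) (fun j => I.vars j 3) (x + w) = qform D (fun j => I.vars j 2) (fun j => I.vars j 3) x
      + qform D (fun j => I.vars j 2) (fun j => I.vars j 3) w + qform D (fun j => I.vars j 2) (fun j => I.vars j 3) 0
      + polar D (fun j => I.vars j 2) (fun j => I.vars j 3) x w := by
  have h0 : qform D (fun j => I.vars j 2) (fun j => I.vars j 3) (0 : Fin n → ZMod 2) = 0 := by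
    simp only [qform, Pi.zero_apply, mul_zero, sum_const_zero]
  rw [qform_add, h0, add_zero]

/-- **R3 for fundamental sets.**  On a pure `(r,3/2)`-expanding instance with simple overlaps, for well-formed bridge data with `#J₀ ≤ r`, the
AND-sum `Q_{D e}` of the fundamental set of every chord `e ∈ N` has rank at least four. -/
theorem rank_four_of_wf (I : LocalMap 4 n m) (hI : I.IsPure xorAndPred) (hS : SimpleOverlap I) {r : ℕ} (hB : BoundaryExpanding r I)
    {B : BridgeData n m} (hW : B.WF I) (hr : B.J₀.card ≤ r) {e : Fin m} (he : e ∈ B.N) :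
    finrank (ZMod 2) (rad (polar (B.D e) (fun j => I.vars j 2) (fun j => I.vars j 3))) + 4 ≤ finrank (ZMod 2) (Fin n → ZMod 2) := by
  have heD : e ∉ B.D e := fun h => (mem_sdiff.1 (hW.hD e he h)).2 he
  have hDr : (B.D e).card ≤ r := (card_le_card ((hW.hD e he).trans sdiff_subset)).trans hr
  exact rank_four_of_family I hI hS hB (two_le_card_of_even I hI hS heD (hW.hDeven e he)) hDr
    (not_star_of_even I hI hS heD (hW.hDeven e he)) (card_xor_bdry_le_two_of_even I hI heD (hW.hDeven e he))

/-! ## The single-read / constant-read regime in instance terms -/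

/-- A private touched by no monomial of `G` has constant read coefficient `[p ∈ C]`. -/
theorem coef_of_unread (I : LocalMap 4 n m) {C : Finset (Fin n)} {G : Finset (Fin m)} {p : Fin n}
    (h : ∀ g ∈ G, I.vars g 2 ≠ p ∧ I.vars g 3 ≠ p) (x : Fin n → ZMod 2) : coef I C G p x = if p ∈ C then 1 else 0 := by
  unfold coef
  rw [sum_eq_zero fun g hg => by rw [if_neg (h g hg).1, if_neg (h g hg).2, add_zero], add_zero]

/-- **Single-read**: if the second constraint touches no private (neither linearly nor through a pendant), the model is single-read. -/
theorem singleRead_of_untouched (I : LocalMap 4 n m) (B : BridgeData n m)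
    (h : ∀ v ∈ privs I B.N, v ∉ B.C₂ ∧ ∀ g ∈ B.G₂, I.vars g 2 ≠ v ∧ I.vars g 3 ≠ v) : (sys I B).SingleRead := by
  intro e x
  by_cases he : e ∈ B.N
  · rw [sys_ρ I B he, sys_ρ' I B he]
    have h2 := h _ (vars_mem_privs I he (s := 2) (by decide))
    have h3 := h _ (vars_mem_privs I he (s := 3) (by decide))
    exact ⟨by rw [coef_of_unread I h2.2, if_neg h2.1], by rw [coef_of_unread I h3.2, if_neg h3.1]⟩
  · rw [(sys_ρ_of_not_mem I B he x).1, (sys_ρ_of_not_mem I B he x).2]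
    exact ⟨rfl, rfl⟩

/-- **Constant reads**: if no pendant of either constraint reads a private, all read vectors are constant. -/
theorem const_of_unread (I : LocalMap 4 n m) (B : BridgeData n m)
    (h : ∀ v ∈ privs I B.N, (∀ g ∈ B.G₁, I.vars g 2 ≠ v ∧ I.vars g 3 ≠ v) ∧ ∀ g ∈ B.G₂, I.vars g 2 ≠ v ∧ I.vars g 3 ≠ v) :
    ∀ e a a', (sys I B).ρ e a = (sys I B).ρ e a' ∧ (sys I B).ρ' e a = (sys I B).ρ' e a' := by
  intro e a a'
  by_cases he : e ∈ B.N
  · have h2 := h _ (vars_mem_privs I he (s := 2) (by decide))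
    have h3 := h _ (vars_mem_privs I he (s := 3) (by decide))
    rw [sys_ρ I B he, sys_ρ' I B he, sys_ρ I B he, sys_ρ' I B he, coef_of_unread I h2.1, coef_of_unread I h2.2,
      coef_of_unread I h3.1, coef_of_unread I h3.2, coef_of_unread I h2.1, coef_of_unread I h2.2, coef_of_unread I h3.1,
      coef_of_unread I h3.2]
    exact ⟨rfl, rfl⟩
  · rw [(sys_ρ_of_not_mem I B he a).1, (sys_ρ_of_not_mem I B he a).2, (sys_ρ_of_not_mem I B he a').1, (sys_ρ_of_not_mem I B he a').2]
    exact ⟨rfl, rfl⟩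

/-! ## (★★) through the R7 table, for a terminal core -/

/-- **Forced chords of a terminal core (memo (★★) + R7).**  Pure typed `(r,3/2)`-expanding instance with simple overlaps; well-formed bridge data
with `#J₀ ≤ r`; the model single-read with constant reads (e.g. `singleRead_of_untouched`, `const_of_unread`), infeasible (e.g.
`infeasible_of_not_solution`) and chord-minimal in `e ∈ N` (e.g. `chordMinimal_of_solution_erase`).  Then with `q := free₂ + b₂` (polar form
`freePolar`) and `Q := Q_{D e}`: (EQ) `Q = q + κ`, or (EXC) `Q = q + ν₁ν₂ + κ` with `ν₁, ν₂` affine, or (NOR) `Z(q)` is a codimension-two flat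
`{λ₁ = λ₂ = 1}` and `Q + γ_e + 1 = (λ₁+1)m₁ + (λ₂+1)m₂`. -/
theorem forced_chord_cases_sys (I : LocalMap 4 n m) (hI : I.IsPure xorAndPred) (hS : SimpleOverlap I) {r : ℕ}
    (hB : BoundaryExpanding r I) {B : BridgeData n m} (hW : B.WF I) (hr : B.J₀.card ≤ r) (hSR : (sys I B).SingleRead)
    (hconst : ∀ e a a', (sys I B).ρ e a = (sys I B).ρ e a' ∧ (sys I B).ρ' e a = (sys I B).ρ' e a')
    (hinf : (sys I B).Infeasible B.N) {e : Fin m} (he : e ∈ B.N) (hM : (sys I B).ChordMinimal B.N e) :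
    (∃ κ : ZMod 2, ∀ x, qform (B.D e) (fun j => I.vars j 2) (fun j => I.vars j 3) x = (((sys I B).F x).2 + (sys I B).t.2) + κ) ∨
    (∃ ν₁ ν₂ : (Fin n → ZMod 2) → ZMod 2, IsAffineFn ν₁ ∧ IsAffineFn ν₂ ∧ ∃ κ : ZMod 2, ∀ x,
      qform (B.D e) (fun j => I.vars j 2) (fun j => I.vars j 3) x = (((sys I B).F x).2 + (sys I B).t.2) + ν₁ x * ν₂ x + κ) ∨
    (∃ a b : Fin n → ZMod 2, freePolar I B.N B.T₂ B.G₂ a b = 1 ∧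
      (∀ x, ((sys I B).F x).2 + (sys I B).t.2 =
        (freePolar I B.N B.T₂ B.G₂ x b + ((((sys I B).F b).2 + (sys I B).t.2) + (((sys I B).F 0).2 + (sys I B).t.2))) *
          (freePolar I B.N B.T₂ B.G₂ x a + ((((sys I B).F a).2 + (sys I B).t.2) + (((sys I B).F 0).2 + (sys I B).t.2))) + 1) ∧
      ∃ m₁ m₂ : (Fin n → ZMod 2) → ZMod 2, IsAffineFn m₁ ∧ IsAffineFn m₂ ∧
        ∀ x, qform (B.D e) (fun j => I.vars j 2) (fun j => I.vars j 3) x + (gam B e + 1) =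
          (freePolar I B.N B.T₂ B.G₂ x b + ((((sys I B).F b).2 + (sys I B).t.2) + (((sys I B).F 0).2 + (sys I B).t.2)) + 1) * m₁ x +
          (freePolar I B.N B.T₂ B.G₂ x a + ((((sys I B).F a).2 + (sys I B).t.2) + (((sys I B).F 0).2 + (sys I B).t.2)) + 1) * m₂ x) :=
  forced_chord_cases (sys I B) hSR hconst hinf he hM (sys_q_add I B) (sys_u_eq I B e) (qform_add' I (B.D e))
    (rank_four_of_wf I hI hS hB hW hr he)

/-! ## Reading (EQ): at most one chord -/

/-- **AND-sums differing by a constant come from the same output family** (pure, simple overlaps: AND pairs are non-degenerate and pairwise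
distinct, so the polar form on basis vectors is the AND-adjacency indicator, `PstarPathRank.polar_basis`). -/
theorem eq_of_qform_eq (I : LocalMap 4 n m) (hI : I.IsPure xorAndPred) (hS : SimpleOverlap I) {D D' : Finset (Fin m)} {κ : ZMod 2}
    (h : ∀ x, qform D (fun j => I.vars j 2) (fun j => I.vars j 3) x = qform D' (fun j => I.vars j 2) (fun j => I.vars j 3) x + κ) :
    D = D' := by
  classical
  have hpol : ∀ v w : Fin n → ZMod 2, polar D (fun j => I.vars j 2) (fun j => I.vars j 3) v w =
      polar D' (fun j => I.vars j 2) (fun j => I.vars j 3) v w := by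
    intro v w
    have h1 := qform_add' I D v w
    have h2 := qform_add' I D' v w
    rw [h (v + w), h v, h w, h (0 : Fin n → ZMod 2), h2] at h1
    generalize qform D' (fun j => I.vars j 2) (fun j => I.vars j 3) v = s at h1
    generalize qform D' (fun j => I.vars j 2) (fun j => I.vars j 3) w = s' at h1
    generalize qform D' (fun j => I.vars j 2) (fun j => I.vars j 3) (0 : Fin n → ZMod 2) = s₀ at h1
    generalize polar D (fun j => I.vars j 2) (fun j => I.vars j 3) v w = t at h1
    generalize polar D' (fun j => I.vars j 2) (fun j => I.vars j 3) v w = t' at h1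
    generalize κ = k at h1
    revert s s' s₀ t t' k h1; decide
  have hadj : ∀ c d : Fin n, AndAdj I D c d ↔ AndAdj I D' c d := by
    intro c d
    have e := hpol (Pi.single c 1) (Pi.single d 1)
    rw [polar_basis I hI hS D, polar_basis I hI hS D'] at e
    by_cases h1 : AndAdj I D c d <;> by_cases h2 : AndAdj I D' c d <;> simp only [h1, h2, if_true, if_false] at e ⊢
    · exact absurd e one_ne_zero
    · exact absurd e zero_ne_one
  -- membership transfers along AND pairs
  have key : ∀ {D D' : Finset (Fin m)}, (∀ c d, AndAdj I D c d → AndAdj I D' c d) → D ⊆ D' := by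
    intro D D' hDD' j hj
    obtain ⟨j', hj', hm⟩ := hDD' _ _ ⟨j, hj, Or.inl ⟨rfl, rfl⟩⟩
    by_cases hjj : j = j'
    · rw [hjj]; exact hj'
    · exfalso
      refine andPair_ne I hI hS hjj ?_
      rcases hm with ⟨h2, h3⟩ | ⟨h2, h3⟩
      · exact Or.inl ⟨h2.symm, h3.symm⟩
      · exact Or.inr ⟨h3.symm, h2.symm⟩
  exact Subset.antisymm (key fun c d => (hadj c d).1) (key fun c d => (hadj c d).2)

/-- **At most one chord of a core is in case (EQ).**  If `Q_{D e} = q + κ` and `Q_{D e'} = q + κ'` for chords `e, e' ∈ N` of well-formed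
bridge data (any common `q`), then `e = e'`. -/
theorem chord_eq_of_EQ (I : LocalMap 4 n m) (hI : I.IsPure xorAndPred) (hS : SimpleOverlap I) {B : BridgeData n m} (hW : B.WF I)
    {q : (Fin n → ZMod 2) → ZMod 2} {e e' : Fin m} (he : e ∈ B.N) (he' : e' ∈ B.N) {κ κ' : ZMod 2}
    (h : ∀ x, qform (B.D e) (fun j => I.vars j 2) (fun j => I.vars j 3) x = q x + κ)
    (h' : ∀ x, qform (B.D e') (fun j => I.vars j 2) (fun j => I.vars j 3) x = q x + κ') : e = e' := by
  have hDD : B.D e = B.D e' := by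
    refine eq_of_qform_eq I hI hS (κ := κ + κ') fun x => ?_
    rw [h x, h' x]
    have h2 : κ' + κ' = 0 := by generalize κ' = t; revert t; decide
    linear_combination (-1 : ZMod 2) * h2
  have heD : e ∉ B.D e := fun hh => (mem_sdiff.1 (hW.hD e he hh)).2 he
  have heD' : e' ∉ B.D e := fun hh => (mem_sdiff.1 (hW.hD e he hh)).2 he'
  exact eq_of_fundamental_eq I hI hS heD heD' (hW.hDeven e he) (hDD ▸ hW.hDeven e' he')

end Summit.PneNP.PneNP.Theorems.PstarChordBridgeForcing
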